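import Mathlib
import Summits.MatrixMultiplication.MatrixMultiplication.Theorems.SnSubsetDichotomyNoThresholdSubsetTripleTransProbSum
import Summits.MatrixMultiplication.MatrixMultiplication.Theorems.SnSubsetDichotomyNoThresholdSubsetTripleTransProbRatio

/-!
# The up-branching rule `Σ_{y addable} f^{Y ∪ y} = (|Y| + 1) · f^Y`

Line `klr-graded-polynomial-method`, crux `SnSubsetDichotomy.NoThresholdSubsetTriple` (stmt-MatrixMultiplication-8302), lead c7.
Composition of the landed Greene–Nijenhuis–Wilf identity `transProb_sum_eq_one` (Σ_y p_y = 1, p154104) with the hook-ratio identity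
`transProb_mul_card_stdFilling` (p_y · (n+1) · f^Y = f^{Y∪y}, p156094): for every Young diagram `Y` with `n` cells, summing the numbers
of standard Young tableaux of the diagrams `Y ∪ y` over the addable nodes `y` gives `(n+1) · f^Y` — the first step of the MODEL theorem
(the prefix-shape process of a uniform same-shape tableau pair is the Plancherel growth with kernel `transProb`).  The diagrams `Y ∪ y`
are supplied by any function `ins` with the right cells, so that no dependent construction appears in the sum.
-/

open scoped BigOperators
open Literature.RepresentationTheory.FiniteGroups (addableNodes IsAddableNode)
open Literature.NumberTheory.DiophantineGeometry (StdFilling)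

namespace Summit.MatrixMultiplication.MatrixMultiplication.Theorems

open PlancherelStep

set_option linter.dupNamespace false in
/-- **Up-branching rule for standard Young tableaux**: `Σ_{y ∈ addableNodes Y} f^{Y ∪ y} = (|Y| + 1) · f^Y`, where `f^Z = Nat.card
(StdFilling |Z| Z)` and `ins y` is any Young diagram with cells `insert y Y.cells` (from Σ_y p_y = 1 and p_y·(n+1)f^Y = f^{Y∪y}).
[folklore; cite: GreeneNijenhuisWilf1979] -/
theorem sum_card_stdFilling_insert : ∀ (Y : YoungDiagram) (ins : ℕ × ℕ → YoungDiagram),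
    (∀ y ∈ addableNodes Y.cells, (ins y).cells = insert y Y.cells) →
      ∑ y ∈ addableNodes Y.cells, (Nat.card (StdFilling (Y.cells.card + 1) (ins y)) : ℝ) =
        ((Y.cells.card + 1 : ℕ) : ℝ) * (Nat.card (StdFilling Y.cells.card Y) : ℝ) := by
  intro Y ins hins
  calc ∑ y ∈ addableNodes Y.cells, (Nat.card (StdFilling (Y.cells.card + 1) (ins y)) : ℝ)
      = ∑ y ∈ addableNodes Y.cells, transProb Y.cells y *
          ((((Y.cells.card + 1 : ℕ) : ℝ)) * (Nat.card (StdFilling Y.cells.card Y) : ℝ)) :=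
        Finset.sum_congr rfl fun y hy => (transProb_mul_card_stdFilling Y (ins y) y hy (hins y hy)).symm
    _ = ((Y.cells.card + 1 : ℕ) : ℝ) * (Nat.card (StdFilling Y.cells.card Y) : ℝ) := by
        rw [← Finset.sum_mul, transProb_sum_eq_one Y.cells Y.isLowerSet, one_mul]

end Summit.MatrixMultiplication.MatrixMultiplication.Theorems
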